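import Mathlib
import Summits.Ventures.FusionMHD.Models.CerfonFreidbergIterLikeQHalfShearDefs
import HarnessLib

/-!
# Ventures/FusionMHD — Models/CerfonFreidbergIterLikeQHalfShearPanels7.lean: KERNEL CHECK of the shear-register certificates of panels 12, 13 (of 32)
# at `ψ_N = 1/2` of THE Cerfon–Freidberg ITER-like instance

HONEST FRAMING (LADDER-GRIDFUSION three columns; CF rung; successor step of «q′(ψ_N = 1/2) on the CF rung», F2-SCOPING v1.6 §10(c)).  One `decide +kernel`
(≈ 80 s): for each listed panel the obligation `CFIterLike.QHalfShear.ShearCert.ok` (`Models/CerfonFreidbergIterLikeQHalfShearDefs.lean`) — the Taylor-model run of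
`progQ = CFIterLike.QHalf.progA ++ blockQ` over ★ #117's parameter box is ACCEPTED and the kernel's panel-integral enclosure of the shear kernel `K·p` along the
approximant lies inside the claimed integers (read off a compiled `#eval` of the same functions, slack one unit of `2⁻⁶⁰`; float truth inside every panel).
MODELLED: analytic Cerfon–Freidberg family; nothing about a device or stability.  No `native_decide`.  Typer/prover: gridfusion-model-5 (g8), 2026-08-27.
Citations: Freidberg 2014 §6.3.5 (6.35) [Freidberg2014]; Mahboubi–Melquiond–Sibut-Pinote 2016 §3.2 Lemma 3 [MahboubiMelquiondSibutpinote2016].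
-/

namespace Summit.Ventures.FusionMHD.Models.CFIterLike.QHalfShear

/-- Shear-register certificate data of panels 12, 13. [instance data] -/
def shearCert7 : List ShearCert := [
  { j := 12, cand := [323790092523263754240, 2427795703041017511936, 14388756993187726229504, 66854846587439054585856, 248281889911147564367872, 652841336599574824878080, 439383275470522656227328, -7985640759666851669082112, -63268339059694125474381824, -331701689125958440202534912, -3746456203233794551166533632, 22483871540001995887470444544, 3630152751518631485029700599808],
    deg := 10, elog2 := 43, plo := -1741839989469983763, phi := -1741839815111781978 },
  { j := 13, cand := [416006821546312663040, 3556386337384796520448, 22309644429206231187456, 104131258904980223950848, 342490870700842063757312, 414558317140967193313280, -4126939901648684997148672, -39961938660027666538692608, -215675047677434505950396416, -773001316873783747578691584, 7688609385997865968065314816, 26256805850286115433740238848, -12123996221027406351422705369088],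
    deg := 10, elog2 := 44, plo := -1641278888744537529, phi := -1641278648264517518 }]

/-- **KERNEL CHECK** of the shear register on panels 12, 13. -/
theorem shearCert7_ok : CFIterLike.QHalfShear.shearCert7.all ShearCert.ok = true := by
  decide +kernel

end Summit.Ventures.FusionMHD.Models.CFIterLike.QHalfShear
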